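import Mathlib.Analysis.SpecialFunctions.Exp
import Mathlib.FieldTheory.IntermediateField.Adjoin.Defs
import Mathlib.FieldTheory.Minpoly.Field
import Mathlib.RingTheory.AlgebraicIndependent.Basic
import Mathlib.Algebra.Algebra.Rat
import HarnessLib

/-!
# Diaz's theorem on `α^β, α^{β²}, …, α^{β^{d-1}}` (large transcendence degree)

Trunk T-TRANSCEND (`Literature/NumberTheory/Transcendental`), problem `Schanuel`, route
`Schanuel/AlgIndepMethod` (`stmt-Schanuel-0086`).

**Diaz 1989** (G. Diaz, *Grands degrés de transcendance pour des familles d'exponentielles*,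
J. Number Theory 31 (1989), 1–23, main theorem; restated as the Corollaire in §3.1 of
M. Laurent, *Sur quelques résultats récents de transcendance*, Astérisque 198–200 (1991),
209–230): let `α` be a nonzero algebraic number and `log α` a **nonzero** determination of its
logarithm, and let `β` be algebraic of degree `d ≥ 2`. Then among the `d - 1` numbers
`α^{βʲ} = e^{βʲ log α}`, `1 ≤ j ≤ d - 1`, at least `⌊(d+1)/2⌋` are algebraically independent,
i.e. `trdeg_ℚ ℚ(α^β, …, α^{β^{d-1}}) ≥ ⌊(d+1)/2⌋`. Gelfond (1949) is the case `d = 3`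
(`α^β, α^{β²}` algebraically independent for cubic `β`); the algebraic independence of all `d - 1`
numbers (Gelfond–Schneider problem) follows from Schanuel's conjecture and is open.

We vendor the statement as the named fact `Literature.NumberTheory.Transcendental.Diaz1989` in the shape of the
neighbouring statements of `PeriodsWave0.lean` (`gelfond_schneider`: algebraicity via
`IsAlgebraic ℚ`, a determination of `log a` as `l` with `cexp l = a`, `l ≠ 0`; transcendence
degrees as `Algebra.trdeg ℚ ↥(IntermediateField.adjoin ℚ …) : Cardinal` compared with a natural
number), plus the definition `gelfondPowers b l d` of the tuple `(e^{bʲ l})_{1 ≤ j ≤ d-1}` and the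
proved specialisation `Diaz1989.gelfond1949` (`d = 3` gives transcendence degree `≥ 2`).

Mathlib has `minpoly`, `IsAlgebraic`, `Algebra.trdeg`, `IntermediateField.adjoin`, `Complex.exp`;
no transcendence results of this kind (searched `Gelfond`, `trdeg` in `NumberTheory`).

## References

* G. Diaz, *Grands degrés de transcendance pour des familles d'exponentielles*, J. Number
  Theory 31 (1989), 1–23.
* M. Laurent, *Sur quelques résultats récents de transcendance*, Journées arithmétiques de Luminy
  1989, Astérisque 198–200 (1991), 209–230, §3.1, Corollaire (statement as above).
* A. O. Gel'fond, Uspekhi Mat. Nauk 4 (1949), no. 5 (the case `d = 3`).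
-/

noncomputable section

open Complex

namespace Literature.NumberTheory.Transcendental

/-- The **Gelfond powers** `α^{βʲ} = e^{bʲ l}`, `1 ≤ j ≤ d - 1`, of `α = e^l` for a determination
`l` of `log α`, indexed by `Fin (d - 1)` (`k ↦ e^{b^{k+1} l}`). [cite: Diaz1989, §1] -/
def gelfondPowers (b l : ℂ) (d : ℕ) : Fin (d - 1) → ℂ :=
  fun k => cexp (b ^ ((k : ℕ) + 1) * l)

/-- The `k`-th Gelfond power is `e^{b^{k+1} l}`. [folklore] -/
@[simp] theorem gelfondPowers_apply (b l : ℂ) (d : ℕ) (k : Fin (d - 1)) :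
    gelfondPowers b l d k = cexp (b ^ ((k : ℕ) + 1) * l) := rfl

/-- **Diaz's theorem** (Diaz 1989, main theorem; Laurent 1991, §3.1, Corollaire [cite: Laurent1991, §3.1 Corollaire]). Let `a ∈ ℂ` be
algebraic and `l` a nonzero determination of `log a` (`cexp l = a`, `l ≠ 0`; this forces `a ≠ 0`
and excludes the trivial branch of `a = 1`), and let `b` be algebraic of degree
`d = deg (minpoly ℚ b) ≥ 2`. Then
`trdeg_ℚ ℚ(e^{b l}, e^{b² l}, …, e^{b^{d-1} l}) ≥ ⌊(d + 1)/2⌋` (natural-number division).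
[cite: Diaz1989, main theorem (Théorème 1)] -/
def Diaz1989 : Prop :=
  ∀ {a b l : ℂ}, IsAlgebraic ℚ a → IsAlgebraic ℚ b → cexp l = a → l ≠ 0 →
    ∀ d : ℕ, (minpoly ℚ b).natDegree = d → 2 ≤ d →
    (((d + 1) / 2 : ℕ) : Cardinal) ≤
      Algebra.trdeg ℚ ↥(IntermediateField.adjoin ℚ (Set.range (gelfondPowers b l d)))

/-- **Gelfond 1949 from Diaz** (the case `d = 3`): for `b` cubic, `⌊(3+1)/2⌋ = 2`, so `e^{b l}` and
`e^{b² l}` (`= α^β, α^{β²}`) generate a field of transcendence degree `≥ 2`, i.e. they are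
algebraically independent. [cite: Gelfond1949] -/
theorem Diaz1989.gelfond1949 (h : Diaz1989) {a b l : ℂ} (ha : IsAlgebraic ℚ a)
    (hb : IsAlgebraic ℚ b) (hl : cexp l = a) (hl0 : l ≠ 0) (hd : (minpoly ℚ b).natDegree = 3) :
    (2 : Cardinal) ≤
      Algebra.trdeg ℚ ↥(IntermediateField.adjoin ℚ (Set.range (gelfondPowers b l 3))) := by
  have := h ha hb hl hl0 3 hd (by norm_num)
  simpa using this

/-- The lower bound `⌊(d+1)/2⌋` is at most the number `d - 1` of generators when `d ≥ 2`, so the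
statement is not vacuously strong (sanity check of the indexing). [folklore] -/
theorem diaz_bound_le (d : ℕ) (hd : 2 ≤ d) : (d + 1) / 2 ≤ d - 1 := by
  omega

end Literature.NumberTheory.Transcendental
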